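import Summits.BirchSwinnertonDyer.Rank1Residual.Iwasawa.KerGZeroCardDvdProd
import Summits.BirchSwinnertonDyer.Rank1Residual.Iwasawa.LocalTowerKernelCardNumeric
import Summits.BirchSwinnertonDyer.Rank1Residual.Additive.GordCycLowerBoundOfControl
import Literature.NumberTheory.EllipticCurves.TamagawaSubgroupProofs
import HarnessLib

/-!
# The LOWER half in rank `0` from the typed input `CycLowerBoundAt` by TAMAGAWA-TOLERANT control:
# the bad-place socket `p ∤ c_ℓ · N_ℓ` of T-CTL-EC weakened to `p ∤ N_ℓ`
# (team n1011, row T-CTL-TAM, seat p06 GEN 10, FILE 4 — the ℚ-shaped rank-`0` CONSUMER of FILES 1–3)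

HONEST FRAMING (cell `b2b-bsdres-*`, team n1011, verbatim): prove what is provable now; shrink each
hard class to its core with data; no claim beyond stated classes. Research route on
CONSTRUCTION-SHAPED X4 / §I N10; TOOL + CONSUMER theorems only — no definition, no named fact,
nothing booked, no residual-map mark moved, no class closed. The typed input
`CycLowerBoundAt W p Dh` (additive-p2, `Additive/GordCycLowerBound`, OPEN) is consumed, not touched;
the UPPER half is not touched.

## What

T-CTL-EC (`Additive/GordCycLowerBoundOfControl`) proved, in rank `0`,
`CycLowerBoundAt ⟹ Typed.MissingLowerBoundAt` (`ord_p #Ш_an ≤ ord_p #Ш`) by control ALONE — behind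
TRIVIAL level-`0` local tower kernels, i.e. at every bad `ℓ ≠ p` the numeric socket `p ∤ c_ℓ · N_ℓ`.
Here `ker g_0` is COUNTED instead of killed (FILE 1 `Iwasawa/KerGZeroCardDvdProd`:
`f_E(0) · #(Sel_∞)_γ = u · #Sel_{p^∞}(E/ℚ) · #ker g_0`, `#ker g_0 ∣ ∏_{v ∈ S} #𝒦_{v,0}[p^∞]`), so with
the typed input `f_E(0) = c · q` (`Reg_p = 1` in rank `0`) and `#Sel_{p^∞}(E/ℚ) = #Ш[p^∞]`:

  `ord_p q ≤ ord_p #Ш + Σ_{v ∈ S} ord_p #𝒦_{v,0}[p^∞]`, `ord_p #Ш_an = ord_p q − ord_p ∏_ℓ c_ℓ`,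

and `MissingLowerBoundAt` follows as soon as `Σ_{v ∈ S} ord_p #𝒦_{v,0}[p^∞] ≤ ord_p Tam(E)` — the
Tamagawa primes `p ∣ c_ℓ` are ABSORBED by the very factor `∏ c_ℓ` of `#Ш_an` that T-CTL-EC discarded.

* CORE♯ `missingLowerBoundAt_rankZero_of_cycLowerBound_of_localCount` — class-agnostic, ABSTRACT
  exponents: `hC : ∀ κ cyclotomic, ∀ v ∈ S, 𝒦_{v,0}[p^∞] finite ∧ #𝒦_{v,0}[p^∞] ≤ p ^ e v`,
  `he : Σ_{v ∈ S} e v ≤ ord_p Tam(E)`, `hgood` (every place off `S` is prime to `p` and good — so `S`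
  contains every bad place and `∏_{v ∈ S} c_v = Tam(E)`; this is where the exponents meet `Tam`),
  `hGZK`, `hr : r_an = 0`, `htors : p ∤ #E(ℚ)_tors`, ONE `Dh` with `hlow : CycLowerBoundAt W p Dh`
  ⟹ `MissingLowerBoundAt W p`. A sharper local count (Greenberg's `c_ℓ^{(p)}` also at `p ∣ N_ℓ`;
  X11b has it in the `GreenbergSelmer` currency, not bridged to this one) plugs into `hC` BY NAME.
* `missingLowerBoundAt_rankZero_of_cycLowerBound_weakSocket` — NUMERIC discharge (`W` globally
  minimal, any prime `p`): `e v := ord_p c_v`; at `v ∈ S` above `p` the socket `hp0` (`𝒦 = ⊥`); at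
  `v ∈ S` away from `p` ONLY `p ∤ N_ℓ` (`N_ℓ = #Ẽ_ns(𝔽_ℓ)`; FILE 3
  `finite_and_natCard_localTowerKerPrimary_zero_le_of_not_dvd`); `he` is the identity
  `Σ_{v∈S} ord_p c_v = ord_p ∏_{v∈S} c_v = ord_p Tam(E)` (`localTamagawaNumber_eq_one_of_hasGoodReductionAt_holds`).
* CLASS ENDS `ClassX4Gord.missingLowerBoundAt_rankZero_of_cycLowerBound_tamagawa` (every odd `p`; the
  socket above `p` is p12's T-T3B F7 `GoodModelLine.ClassX4Gord.localTowerKerPrimary_zero_eq_bot`, no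
  anomaly clause; `htors` from `Irr`) and `ClassX3Gord.…` (explicit `htors`). Binder diff against
  T-CTL-EC's `ClassX4Gord.missingLowerBoundAt_rankZero_of_cycLowerBound_allNumeric`: the ONE clause of
  `hS`, `¬ p ∣ c_ℓ · N_ℓ ↦ ¬ p ∣ N_ℓ`; nothing added.
* CAPSTONES `ClassX4Gord.bsdp_rankZero_of_katoComponent_of_cycLowerBound_tamagawa` (defect `2`, `ρ̄`
  onto, every odd `p`) and `ClassX4Gord.bsdp_rankZero_of_cycLeadingTerm_of_cycLowerBound_tamagawa`
  (any defect, `p ≥ 5`): the tree ENDs `…_of_lower` fed with this lower half.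

NOT claimed: the sharp count at `p ∣ N_ℓ`; the UPPER half and the `W = 0` "`OPEN:TAM`" rows (they
need `#ker g_0 ≥ …`, i.e. Cassels–Poitou–Tate / Greenberg's Lemma 4.7 — not in the tree); rank `1`;
the typed input stays OPEN; census readings are EVIDENCE (r2's instrument). Axioms standard.

References: [GreenbergLNM1716] §3 Lemma 3.3 (pp. 86–88), Lemma 3.5 (p. 90), Prop. 3.8 (pp. 95–96),
§4 Thm. 4.1 and Lemmas 4.2–4.3 (pp. 102–104); [Miller2011LMS] Def. 1.1 (`#Ш_an`);
[MazurTateTeitelbaum1986Invent] §II.4 (`Reg_p = 1` in rank `0`); cells/n1011/skel/T-CTL-TAM.md.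
-/

noncomputable section

open scoped Classical NumberField

open WeierstrassCurve NumberField Literature.NumberTheory.EllipticCurves
  Literature.NumberTheory.EllipticCurves.ModularForms
  Literature.NumberTheory.EllipticCurves.Rank1Residual
  Literature.NumberTheory.EllipticCurves.Rank1Residual.Typed
  IsDedekindDomain Rat.HeightOneSpectrum Summit.BirchSwinnertonDyer.Rank1Residual.Iwasawa

namespace Summit.BirchSwinnertonDyer.Rank1Residual.Additive

variable (W : WeierstrassCurve ℚ) [W.IsElliptic] (p : ℕ) [hp : Fact p.Prime]

/-! ### §0 Bookkeeping -/

/-- The valuation of a natural-number cast into `ℤ_p ⊆ ℚ_p` is non-negative. [folklore] -/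
private theorem valuation_natCast_nonneg (n : ℕ) : 0 ≤ ((n : ℤ_[p]) : ℚ_[p]).valuation :=
  PadicInt.valuation_coe_nonneg

/-- `ord_p` of a finite product of non-zero naturals is the sum of the `ord_p`. [folklore] -/
private theorem padicValNat_finset_prod {ι : Type*} (s : Finset ι) (f : ι → ℕ)
    (hf : ∀ i ∈ s, f i ≠ 0) : padicValNat p (∏ i ∈ s, f i) = ∑ i ∈ s, padicValNat p (f i) := by
  induction s using Finset.cons_induction with
  | empty => simp
  | cons a s ha ih =>
    rw [Finset.prod_cons, Finset.sum_cons,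
      padicValNat.mul (hf a (Finset.mem_cons_self a s))
        (Finset.prod_ne_zero_iff.mpr fun i hi ↦ hf i (Finset.mem_cons_of_mem hi)),
      ih fun i hi ↦ hf i (Finset.mem_cons_of_mem hi)]

/-- `a ∣ b`, `b ≠ 0` ⟹ `ord_p a ≤ ord_p b`. [folklore] -/
private theorem padicValNat_le_of_dvd {a b : ℕ} (hb : b ≠ 0) (h : a ∣ b) :
    padicValNat p a ≤ padicValNat p b := by
  obtain ⟨c, rfl⟩ := h
  rw [padicValNat.mul (left_ne_zero_of_mul hb) (right_ne_zero_of_mul hb)]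
  exact Nat.le_add_right _ _

/-! ### §1 CORE♯: the typed lower half ⟹ `MissingLowerBoundAt` in rank `0`, Tamagawa-tolerant control -/

/-- **CORE♯ (class-agnostic, rank `0`, any prime `p`, ABSTRACT local exponents).** Let `W/ℚ` be
elliptic with analytic rank `0`; grant Gross–Zagier–Kolyvagin (`hGZK`). Assume `p ∤ #E(ℚ)_tors`; let `S`
be a finite set of places off which every place is prime to `p` and of good reduction (`hgood` — so
`S ∋` every bad place and `∏_{v∈S} c_v = Tam(E)`); suppose that for every CYCLOTOMIC `ℤ_p`-extension
`κ` and every `v ∈ S` the `p`-power torsion of the level-`0` local tower kernel is finite of order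
`≤ p ^ e v` (`hC`), with `Σ_{v∈S} e v ≤ ord_p Tam(E)` (`he`), and that `CycLowerBoundAt W p Dh` holds
for ONE height datum. Then `Typed.MissingLowerBoundAt W p` (`ord_p #Ш_an ≤ ord_p #Ш`). Mechanism:
`Reg_p = 1`, `f_E(0) = c·q`; FILE 1: `f_E(0) · #(Sel_∞)_γ = u · #Ш[p^∞] · #ker g_0` with
`#ker g_0 ∣ ∏_{v∈S} #𝒦_{v,0}[p^∞]`; so `ord_p q ≤ ord_p #Ш + Σ e v ≤ ord_p #Ш + ord_p Tam` and
`ord_p #Ш_an = ord_p q − ord_p Tam ≤ ord_p #Ш`. No Delbourgo (A)/(B), no Schneider, no `¬CM`, no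
non-anomalous hypothesis at `p`, no `p ∤ c_ℓ`, no duality.
[cite: GreenbergLNM1716, §3 Lemma 3.5 (p. 90), Prop. 3.8 (pp. 95–96) and §4 Thm. 4.1, Lemmas 4.2–4.3 (pp. 102–104)]
[cite: Miller2011LMS, Def. 1.1] [cite: MazurTateTeitelbaum1986Invent, §II.4] -/
theorem missingLowerBoundAt_rankZero_of_cycLowerBound_of_localCount
    (hGZK : rank_eq_analyticRank_of_analyticRank_le_one) (hr : W.analyticRank = 0)
    (htors : ¬ p ∣ W.torsionOrder) (S : Finset (HeightOneSpectrum (𝓞 ℚ)))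
    (e : HeightOneSpectrum (𝓞 ℚ) → ℕ)
    (hC : ∀ κ : ZpExtension ℚ p, κ.IsCyclotomic → ∀ v ∈ S,
      Finite (W.localTowerKerPrimary κ (v.adicCompletion ℚ) 0) ∧
        Nat.card (W.localTowerKerPrimary κ (v.adicCompletion ℚ) 0) ≤ p ^ e v)
    (hgood : ∀ v ∉ S, (p : 𝓞 ℚ) ∉ v.asIdeal ∧ W.HasGoodReductionAt v)
    (he : ∑ v ∈ S, e v ≤ padicValNat p W.tamagawaProduct)
    (Dh : PAdicHeightData W p) (hlow : CycLowerBoundAt W p Dh) :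
    MissingLowerBoundAt W p := by
  -- Gross–Zagier–Kolyvagin in analytic rank `0`: `rank E(ℚ) = 0`, `E(ℚ)` finite, `Ш` finite
  obtain ⟨hrk, hfin⟩ := hGZK W (by omega)
  have hrank : W.mordellWeilRank = 0 := by rw [hrk, hr]
  haveI : Finite W.toAffine.Point := W.mordellWeilRank_eq_zero_iff_finite.mp hrank
  haveI : Finite W.sha := hfin
  haveI hfinp : Finite (AddCommGroup.primaryComponent W.sha p) := inferInstance
  have hSel : Finite (W.selmerGroupPInfty p) := W.finite_selmerGroupPInfty_of_finite_primaryComponent p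
  have hK := forall_smul_eq_zero_imp_of_not_dvd_torsionOrder W (p := p) htors
  -- the cyclotomic setting, a dual datum, a generator of the characteristic ideal
  obtain ⟨κ, hκ, γ, hγ, hγ'⟩ := exists_isCyclotomic_isTopGenerator_isCyclotomicVariable_holds p
  obtain ⟨D⟩ := W.nonempty_selmerDualData_holds κ γ hγ
  haveI : (Module.charIdeal (IwasawaAlgebra p) D.X).IsPrincipal := charIdeal_isPrincipal_holds p D.X
  obtain ⟨fE, hchar⟩ := Submodule.IsPrincipal.principal (Module.charIdeal (IwasawaAlgebra p) D.X)
  have hchar' : D.charIdeal = Ideal.span {fE} := hchar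
  -- FILE 1: `f_E(0) · #(Sel_∞)_γ = u · #Sel_{p^∞}(E/ℚ) · #ker g_0`, `#ker g_0 ∣ ∏ #𝒦_{v,0}[p^∞]`
  obtain ⟨-, -, -, hH1, hf0, hgfin, hdvd, u, hu⟩ :=
    constantCoeff_mul_natCard_eq_mul_natCard_kerG_of_no_pTorsion W D hγ hSel hK fE hchar' S
      (fun v hv ↦ (hC κ hκ v hv).1)
      (fun v hv ↦ localTowerKerPrimary_zero_eq_bot_of_good W κ (hgood v hv).1 (hgood v hv).2)
  haveI := hgfin
  -- the typed input in rank `0`: `f_E(0) = c · q`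
  obtain ⟨q, c, hlead, hlowEq⟩ := hlow κ γ hκ hγ hγ' D fE hchar'
  have hReg : padicRegulator Dh = 1 := padicRegulator_eq_one_of_finite W p Dh
  rw [hrank, pow_zero, mul_one, hReg, mul_one] at hlowEq
  have hcoeff0 : (PowerSeries.coeff 0 fE : ℤ_[p]) = PowerSeries.constantCoeff fE := by
    rw [PowerSeries.coeff_zero_eq_constantCoeff]
  rw [hcoeff0] at hlowEq
  -- abbreviations in `ℚ_p`
  set A : ℚ_[p] := ((Nat.card (IwasawaDual.EndCoinvariants (W.conjSelmerInfty κ γ - 1)) : ℤ_[p]) :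
    ℚ_[p]) with hA_def
  set N : ℚ_[p] := ((Nat.card ↥(W.selmerGroupPInfty p) : ℤ_[p]) : ℚ_[p]) with hN_def
  set G : ℚ_[p] := ((Nat.card (W.KerG κ 0) : ℤ_[p]) : ℚ_[p]) with hG_def
  set cQ : ℚ_[p] := ((c : ℤ_[p]) : ℚ_[p]) with hcQ_def
  set uQ : ℚ_[p] := ((u : ℤ_[p]) : ℚ_[p]) with huQ_def
  -- `c · q · A = u · N · G` in `ℚ_p`
  have huQ : ((PowerSeries.constantCoeff fE : ℤ_[p]) : ℚ_[p]) * A = uQ * N * G := by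
    rw [hA_def, huQ_def, hN_def, hG_def, ← PadicInt.coe_mul, hu, PadicInt.coe_mul, PadicInt.coe_mul]
  have key : cQ * (q : ℚ_[p]) * A = uQ * N * G := by rw [← hlowEq]; exact huQ
  -- non-vanishing
  have hu0 : uQ ≠ 0 := coe_units_ne_zero p u
  have hNpos : 0 < Nat.card ↥(W.selmerGroupPInfty p) := by
    haveI := hSel; exact Nat.card_pos
  have hN0 : N ≠ 0 := by
    rw [hN_def, PadicInt.coe_natCast]; exact_mod_cast hNpos.ne'
  have hGpos : 0 < Nat.card (W.KerG κ 0) := Nat.card_pos_iff.mpr ⟨⟨0⟩, hgfin⟩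
  have hG0 : G ≠ 0 := by
    rw [hG_def, PadicInt.coe_natCast]; exact_mod_cast hGpos.ne'
  have hApos : 0 < Nat.card (IwasawaDual.EndCoinvariants (W.conjSelmerInfty κ γ - 1)) := by
    haveI := hH1; exact Nat.card_pos
  have hA0 : A ≠ 0 := by
    rw [hA_def, PadicInt.coe_natCast]; exact_mod_cast hApos.ne'
  have hrhs : uQ * N * G ≠ 0 := mul_ne_zero (mul_ne_zero hu0 hN0) hG0
  have hlhs : cQ * (q : ℚ_[p]) * A ≠ 0 := by rw [key]; exact hrhs
  have hc0 : cQ ≠ 0 := fun h ↦ hlhs (by rw [h]; ring)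
  have hqQ : ((q : ℚ) : ℚ_[p]) ≠ 0 := fun h ↦ hlhs (by rw [h]; ring)
  have hq0 : q ≠ 0 := fun h ↦ hqQ (by rw [h, Rat.cast_zero])
  -- valuations: `v(c) + v(q) + v(A) = v(N) + v(G)`, `v(c), v(A) ≥ 0`
  have hval := congrArg Padic.valuation key
  rw [Padic.valuation_mul (mul_ne_zero hc0 hqQ) hA0, Padic.valuation_mul hc0 hqQ,
    Padic.valuation_mul (mul_ne_zero hu0 hN0) hG0, Padic.valuation_mul hu0 hN0, huQ_def,
    valuation_coe_units_eq_zero, zero_add, Padic.valuation_ratCast] at hval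
  have hcnn : 0 ≤ cQ.valuation := PadicInt.valuation_coe_nonneg
  have hAnn : 0 ≤ A.valuation := valuation_natCast_nonneg p _
  have hNval : N.valuation = (padicValNat p W.shaOrder : ℤ) := by
    rw [hN_def, PadicInt.coe_natCast, Padic.valuation_natCast,
      W.card_selmerGroupPInfty_eq_card_primaryComponent_sha p, padicValNat_card_addPrimaryComponent,
      WeierstrassCurve.shaOrder]
  have hGval : G.valuation = (padicValNat p (Nat.card (W.KerG κ 0)) : ℤ) := by
    rw [hG_def, PadicInt.coe_natCast, Padic.valuation_natCast]
  -- `ord_p #ker g_0 ≤ Σ_{v ∈ S} e v ≤ ord_p Tam`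
  have hcardne : ∀ v ∈ S, Nat.card (W.localTowerKerPrimary κ (v.adicCompletion ℚ) 0) ≠ 0 :=
    fun v hv ↦ (Nat.card_pos_iff.mpr ⟨⟨0⟩, (hC κ hκ v hv).1⟩).ne'
  have hGle : padicValNat p (Nat.card (W.KerG κ 0)) ≤ padicValNat p W.tamagawaProduct := by
    refine (padicValNat_le_of_dvd p (Finset.prod_ne_zero_iff.mpr hcardne) hdvd).trans ?_
    rw [padicValNat_finset_prod p S _ hcardne]
    refine (Finset.sum_le_sum fun v hv ↦ ?_).trans he
    haveI := (hC κ hκ v hv).1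
    have hpow := natCard_localTowerKerPrimary_eq_pow_padicValNat W κ (v.adicCompletion ℚ) 0
    have hle : p ^ padicValNat p (Nat.card (W.localTowerKerPrimary κ (v.adicCompletion ℚ) 0)) ≤
        p ^ e v := by rw [← hpow]; exact (hC κ hκ v hv).2
    exact (Nat.pow_le_pow_iff_right hp.out.one_lt).mp hle
  have hqle : padicValRat p q ≤ (padicValNat p W.shaOrder : ℤ) + (padicValNat p W.tamagawaProduct : ℤ) := by
    have h1 : padicValRat p q ≤ N.valuation + G.valuation := by linarith
    rw [hNval, hGval] at h1
    have h2 : ((padicValNat p (Nat.card (W.KerG κ 0)) : ℕ) : ℤ) ≤ (padicValNat p W.tamagawaProduct : ℤ) := by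
      exact_mod_cast hGle
    linarith
  -- the analytic order of `Ш`
  set s : ℚ := q * (W.torsionOrder : ℚ) ^ 2 / (W.tamagawaProduct : ℚ) with hs_def
  refine ⟨s, shaAn_eq_of_leadingLCoeff_eq W hlead, ?_⟩
  have hT0 : W.torsionOrder ≠ 0 := (W.torsionOrder_pos_holds).ne'
  have hTq : (W.torsionOrder : ℚ) ≠ 0 := by exact_mod_cast hT0
  have hPq : (W.tamagawaProduct : ℚ) ≠ 0 := by
    exact_mod_cast (W.tamagawaProduct_pos_holds : 0 < W.tamagawaProduct).ne'
  have htorsval : padicValNat p W.torsionOrder = 0 :=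
    padicValNat.eq_zero_of_not_dvd htors
  rw [hs_def, padicValRat.div (mul_ne_zero hq0 (pow_ne_zero 2 hTq)) hPq,
    padicValRat.mul hq0 (pow_ne_zero 2 hTq), padicValRat.pow, padicValRat.of_nat,
    padicValRat.of_nat, htorsval]
  push_cast at hqle ⊢
  linarith

/-! ### §2 NUMERIC discharge: `e_v = ord_p c_v`; bad places away from `p` need only `p ∤ N_ℓ` -/

omit [W.IsElliptic] hp in
/-- `Tam(E) = ∏_{v ∈ S} c_v` when every place off `S` has good reduction (there `c_v = 1`, tree
`localTamagawaNumber_eq_one_of_hasGoodReductionAt_holds`). [cite: SilvermanAEC2009, VII.2 (remark after Prop. 2.1) and Cor. VII.6.2] -/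
theorem tamagawaProduct_eq_prod_of_good (S : Finset (HeightOneSpectrum (𝓞 ℚ)))
    (hgood : ∀ v ∉ S, W.HasGoodReductionAt v) :
    W.tamagawaProduct = ∏ v ∈ S,
      (W.baseChange (v.adicCompletion ℚ)).localTamagawaNumber (v.adicCompletionIntegers ℚ) := by
  unfold WeierstrassCurve.tamagawaProduct
  refine finprod_eq_prod_of_mulSupport_subset _ fun v hv ↦ ?_
  rw [Finset.mem_coe]
  by_contra hvS
  exact hv (W.localTamagawaNumber_eq_one_of_hasGoodReductionAt_holds v (hgood v hvS))

/-- **NUMERIC form of CORE♯ (`W` globally minimal, any prime `p`)**: at each `v ∈ S` above `p` the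
socket `hp0` (`𝒦_{v,0}[p^∞] = ⊥`, discharged class-wide by T-T3B F7 on the (G-ord) loci); at each
`v ∈ S` away from `p` ONLY `primesEquiv v ≠ p ∧ p ∤ N_ℓ` (FILE 3: `#𝒦_{v,0}[p^∞] ≤ p ^ ord_p c_ℓ`) —
the Tamagawa number `c_ℓ` itself is unrestricted; `Σ_{v∈S} ord_p c_v = ord_p ∏_{v∈S} c_v = ord_p Tam`
by `hgood`. [cite: GreenbergLNM1716, §3 Lemma 3.3 (pp. 86–88), Lemma 3.5 (p. 90), Prop. 3.8 Remark (p. 95) and §4 Thm. 4.1 (pp. 102–104)]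
[cite: Miller2011LMS, Def. 1.1] -/
theorem missingLowerBoundAt_rankZero_of_cycLowerBound_weakSocket [W.IsGloballyMinimal]
    (hGZK : rank_eq_analyticRank_of_analyticRank_le_one) (hr : W.analyticRank = 0)
    (htors : ¬ p ∣ W.torsionOrder) (S : Finset (HeightOneSpectrum (𝓞 ℚ)))
    (hS : ∀ v ∈ S, (p : 𝓞 ℚ) ∉ v.asIdeal →
      (primesEquiv v : ℕ) ≠ p ∧ ¬ p ∣ reductionPointCount W (primesEquiv v : ℕ))
    (hp0 : ∀ (κ : ZpExtension ℚ p), ∀ v ∈ S, (p : 𝓞 ℚ) ∈ v.asIdeal →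
      W.localTowerKerPrimary κ (v.adicCompletion ℚ) 0 = ⊥)
    (hgood : ∀ v ∉ S, (p : 𝓞 ℚ) ∉ v.asIdeal ∧ W.HasGoodReductionAt v)
    (Dh : PAdicHeightData W p) (hlow : CycLowerBoundAt W p Dh) :
    MissingLowerBoundAt W p := by
  -- every `c_v ≠ 0`
  have hcne : ∀ v : HeightOneSpectrum (𝓞 ℚ),
      (W.baseChange (v.adicCompletion ℚ)).localTamagawaNumber (v.adicCompletionIntegers ℚ) ≠ 0 := by
    intro v
    haveI : Fact (Nat.Prime (primesEquiv v : ℕ)) := ⟨(primesEquiv v).2⟩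
    exact left_ne_zero_of_mul
      (localTamagawaNumber_mul_reductionPointCount_ne_zero W v (primesEquiv v : ℕ) rfl)
  refine missingLowerBoundAt_rankZero_of_cycLowerBound_of_localCount W p hGZK hr htors S
    (fun v ↦ padicValNat p
      ((W.baseChange (v.adicCompletion ℚ)).localTamagawaNumber (v.adicCompletionIntegers ℚ)))
    (fun κ _ v hv ↦ ?_) hgood (le_of_eq ?_) Dh hlow
  · by_cases hpv : (p : 𝓞 ℚ) ∈ v.asIdeal
    · rw [hp0 κ v hv hpv]
      exact ⟨inferInstance, by rw [AddSubgroup.card_bot]; exact Nat.one_le_pow _ _ hp.out.pos⟩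
    · obtain ⟨hne, hN⟩ := hS v hv hpv
      haveI : Fact (Nat.Prime (primesEquiv v : ℕ)) := ⟨(primesEquiv v).2⟩
      exact finite_and_natCard_localTowerKerPrimary_zero_le_of_not_dvd W κ v (primesEquiv v : ℕ) rfl
        hne hpv hN
  · rw [tamagawaProduct_eq_prod_of_good W S fun v hv ↦ (hgood v hv).2,
      padicValNat_finset_prod p S _ fun v _ ↦ hcne v]

/-! ### §3 CLASS ENDS: X4♯(G-ord) and X3♯(G-ord), rank `0`, Tamagawa-tolerant -/

variable {W p} in
/-- **X4♯(G-ord), rank `0`, EVERY odd `p` (incl. `3`): the lower half from the typed input by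
Tamagawa-tolerant control.** (`ClassX4Gord = ClassX4 ∧ TypeGOrd`, `ClassX4 = p ≠ 2 ∧ Addv ∧ Irr`.) The
socket above `p` is p12's T-T3B F7 `GoodModelLine.ClassX4Gord.localTowerKerPrimary_zero_eq_bot` (every
`ℤ_p`-extension, no anomaly clause); `p ∤ #E(ℚ)_tors` is `Irr`; at the bad places away from `p` ONLY
`p ∤ N_ℓ = #Ẽ_ns(𝔽_ℓ)` — the Tamagawa numbers are free. Binder diff against T-CTL-EC's
`ClassX4Gord.missingLowerBoundAt_rankZero_of_cycLowerBound_allNumeric`: `hS`'s clause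
`¬ p ∣ c_ℓ · N_ℓ ↦ ¬ p ∣ N_ℓ`, nothing added. X4 stays CONSTRUCTION-SHAPED; the typed input stays
OPEN; nothing booked. [cite: GreenbergLNM1716, §3 Lemma 3.3 (pp. 86–88), Lemma 3.5 (p. 90), Lemma 3.4 (p. 89) and §4 Thm. 4.1 (pp. 102–104)]
[cite: Miller2011LMS, Def. 1.1] -/
theorem ClassX4Gord.missingLowerBoundAt_rankZero_of_cycLowerBound_tamagawa [W.IsGloballyMinimal]
    (hX : ClassX4Gord W p) (hGZK : rank_eq_analyticRank_of_analyticRank_le_one)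
    (hr : W.analyticRank = 0) (S : Finset (HeightOneSpectrum (𝓞 ℚ)))
    (hS : ∀ v ∈ S, (p : 𝓞 ℚ) ∉ v.asIdeal →
      (primesEquiv v : ℕ) ≠ p ∧ ¬ p ∣ reductionPointCount W (primesEquiv v : ℕ))
    (hgood : ∀ v ∉ S, (p : 𝓞 ℚ) ∉ v.asIdeal ∧ W.HasGoodReductionAt v)
    (Dh : PAdicHeightData W p) (hlow : CycLowerBoundAt W p Dh) :
    MissingLowerBoundAt W p :=
  missingLowerBoundAt_rankZero_of_cycLowerBound_weakSocket W p hGZK hr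
    (Supersingular.not_dvd_torsionOrder_of_irr W p hX.1.2.2) S hS
    (fun κ _ _ hpv ↦ GoodModelLine.ClassX4Gord.localTowerKerPrimary_zero_eq_bot hX hpv κ) hgood Dh
    hlow

variable {W p} in
/-- **X3♯(G-ord), rank `0`, EVERY odd `p`, `p ∤ #E(ℚ)_tors` explicit: the lower half from the typed
input by Tamagawa-tolerant control** (`ClassX3Gord = ClassX3 ∧ TypeGOrd`; reducible rows may carry
rational `p`-torsion, hence `htors`). Socket above `p`: T-T3B F7
`GoodModelLine.ClassX3Gord.localTowerKerPrimary_zero_eq_bot`; away from `p`: `p ∤ N_ℓ` only. X3 stays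
as labelled; nothing booked. [cite: GreenbergLNM1716, §3 Lemma 3.3 (pp. 86–88), Lemma 3.5 (p. 90), Lemma 3.4 (p. 89) and §4 Thm. 4.1 (pp. 102–104)]
[cite: Miller2011LMS, Def. 1.1] -/
theorem ClassX3Gord.missingLowerBoundAt_rankZero_of_cycLowerBound_tamagawa [W.IsGloballyMinimal]
    (hp2 : p ≠ 2) (hX : ClassX3Gord W p) (hGZK : rank_eq_analyticRank_of_analyticRank_le_one)
    (hr : W.analyticRank = 0) (htors : ¬ p ∣ W.torsionOrder) (S : Finset (HeightOneSpectrum (𝓞 ℚ)))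
    (hS : ∀ v ∈ S, (p : 𝓞 ℚ) ∉ v.asIdeal →
      (primesEquiv v : ℕ) ≠ p ∧ ¬ p ∣ reductionPointCount W (primesEquiv v : ℕ))
    (hgood : ∀ v ∉ S, (p : 𝓞 ℚ) ∉ v.asIdeal ∧ W.HasGoodReductionAt v)
    (Dh : PAdicHeightData W p) (hlow : CycLowerBoundAt W p Dh) :
    MissingLowerBoundAt W p :=
  missingLowerBoundAt_rankZero_of_cycLowerBound_weakSocket W p hGZK hr htors S hS
    (fun κ _ _ hpv ↦ GoodModelLine.ClassX3Gord.localTowerKerPrimary_zero_eq_bot hp2 hX hpv κ) hgood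
    Dh hlow

/-! ### §4 CAPSTONES: `BSD(E,p)` on rank-`0` X4♯(G-ord) rows from ONE typed input, Tamagawa-tolerant -/

variable {W p} in
/-- **X4♯(G-ord) ∩ `I₀*` (defect `e = 2`), `r_an = 0`, `ρ̄_{E,p}` onto, EVERY odd `p` (at `p = 3`:
`Ram`): `BSD(E,p)` from PRINTED facts (Kato 2004 Thm. 17.4 (3) component `hK`, Delbourgo 1998 Prop. 4
`hDel98`, GZK, modularity), census place data with ONLY `p ∤ N_ℓ` at the bad `ℓ ≠ p` (Tamagawa
numbers free), and the ONE typed input `CycLowerBoundAt W p Dh`** — the tree END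
`ClassX4Gord.bsdp_rankZero_of_katoComponent_of_lower` fed with this file's Tamagawa-tolerant lower half.
X4 stays CONSTRUCTION-SHAPED (the typed input is OPEN); nothing booked.
[cite: Kato2004Asterisque, Thm. 17.4 (3) (p. 273)] [cite: Delbourgo1998, Prop. 4 (p. 144)]
[cite: GreenbergLNM1716, §3 Lemma 3.5 (p. 90), Prop. 3.8 (pp. 95–96) and §4 Thm. 4.1 (pp. 102–104)] [cite: Miller2011LMS, Def. 1.1] -/
theorem ClassX4Gord.bsdp_rankZero_of_katoComponent_of_cycLowerBound_tamagawa [W.IsGloballyMinimal]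
    (hK : Kato2004.charIdeal_dvd_padicLFunctionBranch_component_of_surjective)
    (hDel98 : Delbourgo1998.prop4_rankZero_pow_dvd_constantCoeff)
    (hGZK : rank_eq_analyticRank_of_analyticRank_le_one) (hmod : hasEntireLFunction_rat)
    (hmodD : nonempty_modularParametrizationData)
    (hX : ClassX4Gord W p) (he : semistabilityIndex W p = 2) (hr : W.analyticRank = 0)
    (hsurj : Surj W p) (hram3 : p = 3 → Ram W p) (S : Finset (HeightOneSpectrum (𝓞 ℚ)))
    (hS : ∀ v ∈ S, (p : 𝓞 ℚ) ∉ v.asIdeal →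
      (primesEquiv v : ℕ) ≠ p ∧ ¬ p ∣ reductionPointCount W (primesEquiv v : ℕ))
    (hgood : ∀ v ∉ S, (p : 𝓞 ℚ) ∉ v.asIdeal ∧ W.HasGoodReductionAt v)
    (Dh : PAdicHeightData W p) (hlow : CycLowerBoundAt W p Dh) : BSDp W p :=
  ClassX4Gord.bsdp_rankZero_of_katoComponent_of_lower hK hDel98 hGZK hmod hmodD hX he hr hsurj hram3
    (ClassX4Gord.missingLowerBoundAt_rankZero_of_cycLowerBound_tamagawa hX hGZK hr S hS hgood Dh hlow)

variable {W p} in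
/-- **X4♯(G-ord), ANY defect, `p ≥ 5`, `r_an = 0`: `BSD(E,p)` from the TWO typed cyclotomic inputs at
`T = 0` (`CycLeadingTermAt W p` above, `CycLowerBoundAt W p Dh` below), Delbourgo 1998 Prop. 4, GZK,
modularity and census place data with ONLY `p ∤ N_ℓ` at the bad `ℓ ≠ p`** — the tree END
`ClassX4Gord.bsdp_rankZero_of_cycLeadingTerm_of_lower` fed with the Tamagawa-tolerant lower half. X4
stays CONSTRUCTION-SHAPED (both typed inputs OPEN off the defect-2 rows); nothing booked.
[cite: Delbourgo1998, Prop. 4 (p. 144)] [cite: GreenbergLNM1716, §3 Lemma 3.5 (p. 90), Prop. 3.8 (pp. 95–96) and §4 Thm. 4.1 (pp. 102–104)]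
[cite: Miller2011LMS, Def. 1.1] -/
theorem ClassX4Gord.bsdp_rankZero_of_cycLeadingTerm_of_cycLowerBound_tamagawa [W.IsGloballyMinimal]
    (hDel98 : Delbourgo1998.prop4_rankZero_pow_dvd_constantCoeff)
    (hGZK : rank_eq_analyticRank_of_analyticRank_le_one) (hmod : hasEntireLFunction_rat)
    (hX : ClassX4Gord W p) (hp5 : 5 ≤ p) (hr : W.analyticRank = 0) (hLT : CycLeadingTermAt W p)
    (S : Finset (HeightOneSpectrum (𝓞 ℚ)))
    (hS : ∀ v ∈ S, (p : 𝓞 ℚ) ∉ v.asIdeal →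
      (primesEquiv v : ℕ) ≠ p ∧ ¬ p ∣ reductionPointCount W (primesEquiv v : ℕ))
    (hgood : ∀ v ∉ S, (p : 𝓞 ℚ) ∉ v.asIdeal ∧ W.HasGoodReductionAt v)
    (Dh : PAdicHeightData W p) (hlow : CycLowerBoundAt W p Dh) : BSDp W p :=
  ClassX4Gord.bsdp_rankZero_of_cycLeadingTerm_of_lower hDel98 hGZK hmod hX hp5 hr hLT
    (ClassX4Gord.missingLowerBoundAt_rankZero_of_cycLowerBound_tamagawa hX hGZK hr S hS hgood Dh hlow)

end Summit.BirchSwinnertonDyer.Rank1Residual.Additive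

end
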